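import Summits.Ventures.PercRepro.ProfileFlatUpsetLineRankFive

/-!
# PercRepro — (G) AT THE PRINCIPAL UP-SET OF A TWO-POINT LINE ON `2r − 2` POINTS, EVERY RANK, WHEN THE COGIRTH IS AT LEAST `r − 3`
(p10, gen 20; `proofs/P10-AVFULL.md` §28(j))

The rank-5 module's double counting `#depL ≤ #bothL` on `Z ⊆ B` runs at EVERY rank once the lower degree of a `depL`
set is read through the cogirth: a `depL` set `B` lies above at least `#(E ∖ H)` sets of `bothL`, `H = cl ((E ∖ B) ∪ F₀)`
a hyperplane, and `#(E ∖ H) ≥ g` when `CogirthGe M g` (`le_card_bipartiteAbove_depL_of_cogirth`); a `bothL` set lies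
below at most `r − 3` sets of `depL` at every rank — the points of `eraseDep` are coloops of `D = (E ∖ Z) ∪ F₀`
(`#D = r + 1`, `rk D = r`), removing `k` of them leaves a set of rank `r − k` containing `F₀`, and `k ≥ r − 2` would put
that set inside `cl F₀ = F₀` (`rk_sdiff_add_card_eq_of_coloops`, `card_eraseDep_add_three_le`).  So with `g ≥ r − 3`
the counting closes (`card_depL_le_card_bothL_of_cogirth`) and THEOREM `sum_sepSets_principal_line_nonneg_of_cogirth`:
(G) at `↑{e, f}` on `2r − 2` points for every finite matroid of cogirth `≥ r − 3` (`r ≥ 4`; the coloop cases as in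
the rank-5 module).  The rank-5 theorem is the case `g = 2` (no coloop).  Census (own code, gen 20, cosimple.py):
at `n = 10` the degree pairs of coloop-free instances are `(≥ 3, ≤ 3)` exactly when `M` has no series pair, i.e.
cogirth `≥ 3 = r − 3`; with series pairs the plain counting fails.  Nothing is asserted below cogirth `r − 3`.
-/

open scoped Matroid

namespace PercRepro.Cogirth

open Finset ThmH Skew

variable {α : Type} [DecidableEq α] {M : Matroid α} [M.Finite]

/-! ### Removing a set of coloops drops the rank by its size -/

/-- Removing a set `X` of coloops of `D` drops the rank of `D` by exactly `#X`. -/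
theorem rk_sdiff_add_card_eq_of_coloops {D : Finset α} (hD : D ⊆ gr M) {X : Finset α} (hXD : X ⊆ D)
    (hX : ∀ x ∈ X, rk M (D.erase x) + 1 = rk M D) : rk M (D \ X) + X.card = rk M D := by
  induction X using Finset.induction_on with
  | empty => rw [sdiff_empty, card_empty, Nat.add_zero]
  | insert x X hxX ih =>
    have hxD : x ∈ D := hXD (mem_insert_self x X)
    have hXD' : X ⊆ D := (subset_insert x X).trans hXD
    have ih' := ih hXD' (fun y hy => hX y (mem_insert_of_mem hy))
    have hxDX : x ∈ D \ X := mem_sdiff.2 ⟨hxD, hxX⟩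
    have hco := rk_erase_of_coloop_subset hD (sdiff_subset (s := D) (t := X)) hxDX (hX x (mem_insert_self x X))
    have hsd : D \ insert x X = (D \ X).erase x := by
      ext y
      simp only [mem_sdiff, mem_insert, mem_erase, not_or]
      constructor
      · rintro ⟨hy, hyx, hyX⟩; exact ⟨hyx, hy, hyX⟩
      · rintro ⟨hyx, hy, hyX⟩; exact ⟨hy, hyx, hyX⟩
    rw [hsd, card_insert_of_notMem hxX]
    omega

/-- At every rank, a set of `bothL` has at most `r − 3` points in `eraseDep`. -/
theorem card_eraseDep_add_three_le {F₀ : Finset α} (hF : IsFlatF M F₀) (hN : (gr M).card + 2 = 2 * rk M (gr M))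
    {e f : α} (hef : e ≠ f) (hF₀ : F₀ = {e, f}) (hrF : rk M F₀ = 2) {Z : Finset α} (hZ : Z ∈ bothL M F₀ e f) :
    (eraseDep M F₀ Z).card + 3 ≤ rk M (gr M) := by
  rw [mem_bothL] at hZ
  obtain ⟨hZn, hFZ, hecl, _⟩ := hZ
  obtain ⟨hZs, hZc⟩ := mem_negTwo.1 hZn
  obtain ⟨_, _, hsum⟩ := bounds_of_mem_sepSets_principal hF hZs
  obtain ⟨_, _, hZcr⟩ := mem_biIndepAll.1 (mem_sepSets.1 hZs).1
  have heF : e ∈ F₀ := by rw [hF₀]; exact mem_insert_self e {f}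
  have heg : e ∈ gr M := hF.1 heF
  have hF₀c : F₀.card = 2 := by rw [hF₀]; exact card_pair hef
  have hdisj : Disjoint (gr M \ Z) F₀ := by
    rw [disjoint_left]
    intro y hy hyF
    exact (mem_sdiff.1 hy).2 (hFZ hyF)
  -- `D = (E ∖ Z) ∪ F₀` has `r + 1` points and rank `r`
  have hDg : (gr M \ Z) ∪ F₀ ⊆ gr M := union_subset sdiff_subset hF.1
  have hDc : ((gr M \ Z) ∪ F₀).card + 1 = rk M (gr M) + 2 := by
    rw [card_union_of_disjoint hdisj, hF₀c]
    omega
  have hDr : rk M ((gr M \ Z) ∪ F₀) = rk M (gr M) := by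
    have henot : e ∉ gr M \ Z := fun h => (mem_sdiff.1 h).2 (hFZ heF)
    have h1 : rk M (insert e (gr M \ Z)) = (insert e (gr M \ Z)).card :=
      rk_insert_eq_card_of_notMem_clF heg sdiff_subset hZcr henot hecl
    rw [card_insert_of_notMem henot] at h1
    have h2 : rk M (insert e (gr M \ Z)) ≤ rk M ((gr M \ Z) ∪ F₀) :=
      rk_mono_fu (insert_subset (mem_union_right _ heF) subset_union_left)
    have h3 : rk M ((gr M \ Z) ∪ F₀) ≤ rk M (gr M) := rk_mono_fu hDg
    omega
  -- the points of `eraseDep` are coloops of `D`, outside `F₀`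
  have hsubD : eraseDep M F₀ Z ⊆ (gr M \ Z) ∪ F₀ := by
    intro x hx
    unfold eraseDep at hx
    exact mem_union_left _ (mem_filter.1 hx).1
  have hXF : ∀ x ∈ eraseDep M F₀ Z, x ∉ F₀ := by
    intro x hx hxF
    unfold eraseDep at hx
    exact (mem_sdiff.1 (mem_filter.1 hx).1).2 (hFZ hxF)
  have hcol : ∀ x ∈ eraseDep M F₀ Z, rk M (((gr M \ Z) ∪ F₀).erase x) + 1 = rk M ((gr M \ Z) ∪ F₀) := by
    intro x hx
    have hxF := hXF x hx
    unfold eraseDep at hx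
    rw [mem_filter] at hx
    rw [erase_union_distrib, erase_eq_of_notMem hxF, hDr]
    exact hx.2
  have hW := rk_sdiff_add_card_eq_of_coloops hDg hsubD hcol
  -- `W = D ∖ eraseDep` contains `F₀`
  have hFW : F₀ ⊆ ((gr M \ Z) ∪ F₀) \ eraseDep M F₀ Z := fun y hy =>
    mem_sdiff.2 ⟨mem_union_right _ hy, fun h => hXF y h hy⟩
  have hWc : (((gr M \ Z) ∪ F₀) \ eraseDep M F₀ Z).card + (eraseDep M F₀ Z).card = ((gr M \ Z) ∪ F₀).card := by
    rw [card_sdiff_of_subset hsubD]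
    have := card_le_card hsubD
    omega
  by_contra hcon
  -- then `rk W ≤ 2 = rk F₀`, so `W ⊆ cl F₀ = F₀` has at most two points, forcing `rk W ≤ 1 < rk F₀`
  have hWr : rk M (((gr M \ Z) ∪ F₀) \ eraseDep M F₀ Z) ≤ rk M F₀ := by rw [hrF]; omega
  have hWsub : ((gr M \ Z) ∪ F₀) \ eraseDep M F₀ Z ⊆ F₀ := by
    have := subset_clF_of_rk_le (sdiff_subset.trans hDg) hFW hWr
    rwa [hF.2] at this
  have hWc2 := card_le_card hWsub
  have hrW : rk M F₀ ≤ rk M (((gr M \ Z) ∪ F₀) \ eraseDep M F₀ Z) := rk_mono_fu hFW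
  omega

/-! ### The lower degree through the cogirth -/

/-- With cogirth at least `g`, a `depL` set lies above at least `g` sets of `bothL`. -/
theorem le_card_bipartiteAbove_depL_of_cogirth {F₀ : Finset α} (hF : IsFlatF M F₀) {e f : α}
    (hF₀ : F₀ = {e, f}) {g : ℕ} (hg : CogirthGe M g) {B : Finset α} (hB : B ∈ depL M F₀ e f) :
    g ≤ ((bothL M F₀ e f).bipartiteAbove (fun (B Z : Finset α) => Z ⊆ B) B).card := by
  have hB' := hB
  rw [mem_depL] at hB'
  obtain ⟨hBp, hFB, _, _, hdep⟩ := hB'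
  have hBg : B ⊆ gr M := (mem_biIndepAll.1 (mem_sepSets.1 (mem_posTwo.1 hBp).1).1).1
  -- the candidate points inject into the neighbours
  have hXcard : ((B \ F₀).filter (fun x => x ∉ clF M ((gr M \ B) ∪ F₀))).card ≤
      ((bothL M F₀ e f).bipartiteAbove (fun (B Z : Finset α) => Z ⊆ B) B).card := by
    apply card_le_card_of_injOn (fun x => B.erase x)
    · intro x hx
      rw [mem_coe, mem_filter, mem_sdiff] at hx
      rw [mem_coe, mem_bipartiteAbove]
      exact ⟨erase_mem_bothL_of_mem_depL hF hF₀ hB hx.1.1 hx.1.2 hx.2, erase_subset x B⟩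
    · intro x hx y hy hxy
      rw [mem_coe, mem_filter, mem_sdiff] at hx hy
      have hxy' : B.erase x = B.erase y := hxy
      by_contra hne
      have : x ∈ B.erase y := mem_erase.2 ⟨hne, hx.1.1⟩
      rw [← hxy'] at this
      exact (mem_erase.1 this).1 rfl
  refine le_trans ?_ hXcard
  -- the hyperplane `H` misses at least `g` points, all of them candidates
  have hH : rk M (clF M ((gr M \ B) ∪ F₀)) + 1 = rk M (gr M) := by rw [rk_clF_eq_fu]; exact hdep
  have hgH := hg _ (clF_subset_gr_fu _) hH
  refine le_trans hgH (card_le_card ?_)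
  intro z hz
  rw [mem_sdiff] at hz
  rw [mem_filter, mem_sdiff]
  have hzB : z ∈ B := by
    by_contra hzB
    exact hz.2 (subset_clF_fu (union_subset sdiff_subset hF.1) (mem_union_left _ (mem_sdiff.2 ⟨hz.1, hzB⟩)))
  have hzF : z ∉ F₀ := fun h => hz.2 (subset_clF_fu (union_subset sdiff_subset hF.1) (mem_union_right _ h))
  exact ⟨⟨hzB, hzF⟩, hz.2⟩

/-- **`#depL ≤ #bothL`** at every rank `r ≤ g + 3` when the cogirth is at least `g ≥ 1`. -/
theorem card_depL_le_card_bothL_of_cogirth {F₀ : Finset α} (hF : IsFlatF M F₀)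
    (hN : (gr M).card + 2 = 2 * rk M (gr M)) {e f : α} (hef : e ≠ f) (hF₀ : F₀ = {e, f}) (hrF : rk M F₀ = 2)
    {g : ℕ} (hg : CogirthGe M g) (hg3 : rk M (gr M) ≤ g + 3) (hgpos : 0 < g) :
    (depL M F₀ e f).card ≤ (bothL M F₀ e f).card := by
  have h := card_mul_le_card_mul (fun (B Z : Finset α) => Z ⊆ B) (s := depL M F₀ e f) (t := bothL M F₀ e f)
    (m := g) (n := g) (fun B hB => le_card_bipartiteAbove_depL_of_cogirth hF hF₀ hg hB)
    (fun Z hZ => by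
      have h1 := (card_le_card (bipartiteBelow_depL_subset_image hZ)).trans card_image_le
      have h2 := card_eraseDep_add_three_le hF hN hef hF₀ hrF hZ
      omega)
  exact Nat.le_of_mul_le_mul_right h hgpos

/-- With cogirth `≥ g`, `r ≤ g + 3`, `g ≥ 1`, the class `(B) ∪ (D)` of `e` has non-negative weight. -/
theorem sum_sepBD_nonneg_of_cogirth {F₀ : Finset α} (hF : IsFlatF M F₀)
    (hN : (gr M).card + 2 = 2 * rk M (gr M)) {e f : α} (hef : e ≠ f) (hF₀ : F₀ = {e, f}) (hrF : rk M F₀ = 2)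
    {g : ℕ} (hg : CogirthGe M g) (hg3 : rk M (gr M) ≤ g + 3) (hgpos : 0 < g) :
    0 ≤ ∑ Z ∈ sepB M (principalUp M F₀) e, (2 * (Z.card : ℤ) - (gr M).card - 1) +
      ∑ Z ∈ sepD M (principalUp M F₀) e, (2 * (Z.card : ℤ) - (gr M).card - 1) := by
  have hB : sepB M (principalUp M F₀) e ⊆ sepSets M (principalUp M F₀) := by unfold sepB; exact filter_subset _ _
  have hD : sepD M (principalUp M F₀) e ⊆ sepSets M (principalUp M F₀) := by unfold sepD; exact filter_subset _ _
  rw [sum_term_eq_of_subset hF hN hB, sum_term_eq_of_subset hF hN hD]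
  have h1 := card_negB_le hF hN hF₀
  have h2 := card_depL_le_card_bothL_of_cogirth hF hN hef hF₀ hrF hg hg3 hgpos
  have h3 := card_bothL_union_negD_le hF hN hef hF₀
  rw [card_union_of_disjoint disjoint_bothL_negD] at h3
  unfold negB posB negD posD at *
  have h4 : ((sepB M (principalUp M F₀) e).filter (fun Z => Z ∈ negTwo M F₀)).card +
      ((sepD M (principalUp M F₀) e).filter (fun Z => Z ∈ negTwo M F₀)).card ≤
      ((sepB M (principalUp M F₀) e).filter (fun Z => Z ∈ posTwo M F₀)).card +
      ((sepD M (principalUp M F₀) e).filter (fun Z => Z ∈ posTwo M F₀)).card := by omega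
  have h4' : (((sepB M (principalUp M F₀) e).filter (fun Z => Z ∈ negTwo M F₀)).card : ℤ) +
      ((sepD M (principalUp M F₀) e).filter (fun Z => Z ∈ negTwo M F₀)).card ≤
      ((sepB M (principalUp M F₀) e).filter (fun Z => Z ∈ posTwo M F₀)).card +
      ((sepD M (principalUp M F₀) e).filter (fun Z => Z ∈ posTwo M F₀)).card := by exact_mod_cast h4
  linarith

/-! ### The theorem -/

/-- **(G) AT THE PRINCIPAL UP-SET OF A TWO-POINT LINE ON `2r − 2` POINTS WHEN THE COGIRTH IS AT LEAST `r − 3`**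
(`g ≥ 1`, `r ≤ g + 3`): for every finite matroid `M` with `CogirthGe M g` on `2r − 2` points and every flat
`F₀ = {e, f}` of rank `2`, the signed sum over the separated sets of `principalUp M F₀` is non-negative. -/
theorem sum_sepSets_principal_line_nonneg_of_cogirth {F₀ : Finset α} (hF : IsFlatF M F₀) {e f : α}
    (hef : e ≠ f) (hF₀ : F₀ = {e, f}) (hrF : rk M F₀ = 2) (hN : (gr M).card + 2 = 2 * rk M (gr M)) {g : ℕ}
    (hg : CogirthGe M g) (hg3 : rk M (gr M) ≤ g + 3) (hgpos : 0 < g) :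
    0 ≤ ∑ Z ∈ sepSets M (principalUp M F₀), (2 * (Z.card : ℤ) - (gr M).card - 1) := by
  by_cases hco : ∃ y ∈ gr M, rk M ((gr M).erase y) + 1 = rk M (gr M)
  · obtain ⟨y, hy, hco⟩ := hco
    have hle : (negTwo M F₀).card ≤ (posTwo M F₀).card := by
      by_cases hyF : y ∈ F₀
      · exact card_negTwo_le_card_posTwo_of_coloop_mem hF hN hyF hco
      · exact card_negTwo_le_card_posTwo_of_coloop_notMem hF hN hy hyF hco
    rw [sum_term_eq_of_subset hF hN (Subset.refl _)]
    have hP : (sepSets M (principalUp M F₀)).filter (fun Z => Z ∈ posTwo M F₀) = posTwo M F₀ := by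
      ext Z; rw [mem_filter]; exact ⟨fun h => h.2, fun h => ⟨(mem_posTwo.1 h).1, h⟩⟩
    have hN'' : (sepSets M (principalUp M F₀)).filter (fun Z => Z ∈ negTwo M F₀) = negTwo M F₀ := by
      ext Z; rw [mem_filter]; exact ⟨fun h => h.2, fun h => ⟨(mem_negTwo.1 h).1, h⟩⟩
    rw [hP, hN'']
    have : ((negTwo M F₀).card : ℤ) ≤ (posTwo M F₀).card := by exact_mod_cast hle
    linarith
  · have heF : e ∈ F₀ := by rw [hF₀]; exact mem_insert_self e {f}
    exact sum_sepSets_principal_nonneg_of_sepBD hF hN heF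
      (sum_sepBD_nonneg_of_cogirth hF hN hef hF₀ hrF hg hg3 hgpos)

end PercRepro.Cogirth
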